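import Summits.NavierStokesRegularity.OSWSelfSimilar.SheetRowThirdHilbert
import Summits.NavierStokesRegularity.OSWSelfSimilar.GCLMGaugeAOriginRatesIntegrals
import HarnessLib

/-!
# Viscous gCLM/OSW profile MODEL in the dynamic-rescaling gauge A: the EXACT initial rates of the registered datum
# `Ω₀(ξ) = −2ξ/(1+ξ²)²` (kernel anchor of the class-(D) runs of case Z3-E12⁻ and its twin)

HONEST FRAMING (cell ns-blowup GROUP B «PROFILE SEARCH», zone Z3, case Z3-E12⁻ (eng-3 g5, `HOME/profile/z3/PREREG-E12NEG.md` §2 (D))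
and its second-code twin (eng-5 g7, `HOME/profile/z3twin/e12neg/`); human rulings D-0035/D-0074): **1-D MODEL (viscous generalised
Constantin–Lax–Majda / Okamoto–Sakajo–Wunsch equation on `ℝ`, `ν`-MODEL dissipation `εΩ″`); not Euler, not Navier–Stokes;
«violates: none — MODEL».** Nothing here is a statement about Navier–Stokes.

OBJECT. The profile operator of the sheet (`SheetRowThirdExactFamily`, `HOME/profile/z3/SHEET.md` §1.2)
  `G(Ω; c_ω, c_l, a, ε)(ξ) = c_ω Ω + c_l ξ Ω′ + a 𝒰 Ω′ − (HΩ) Ω − ε Ω″`,  `𝒰′ = HΩ`, `𝒰(0) = 0`,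
and the class-(D) dynamic rescaling `∂_τ Ω = −G(Ω; c_ω(τ), c_l(τ), a, ε(τ))` in GAUGE A, i.e. with `(c_ω, c_l)` chosen at every `τ` so that
the two origin functionals `Ω′(0, τ)` and `(HΩ)(0, τ)` are constants of the motion:  `∂_ξ[G(Ω)](0) = 0` and `H[G(Ω)](0) = 0`.
For the registered datum `Ω₀(ξ) = −2ξ/(1+ξ²)² = −2·profile ξ` (pins `Ω₀′(0) = −2`, `HΩ₀(0) = 1`; velocity `𝒰₀(ξ) = ξ/(1+ξ²)`)
these two linear conditions are solved here in CLOSED FORM: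

  **`c_ω(0⁺) = 1/2 − a/4 − 6ε`,  `c_l(0⁺) = 1/2 − 3a/4 − 6ε`**  (`gaugeA_origin_rates_iff`),

so the rescaled amplitude of this datum GROWS at `τ = 0` iff `ε < (2 − a)/24` (`growth_phase_iff`): at `a = −1/2` iff `ε < 5/48`.
This is the exact statement behind the census rider «the `ε₀ ≥ 0.1` rows of Z3-E12⁻ carry no amplification phase in the `dt → 0`
problem; their printed `τ_a ≈ 2dt`, `s_max = (1/2 − a/4)·dt` are the inviscid first step» (eng-5 g7 RESULT line), and every class-(D)
run of both codes reproduces the two rates to `1e-12` at `τ = 0`.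

WHAT IS KERNEL-CHECKED HERE (no cited gap; the GENUINE p.v. Hilbert transform `Literature.Analysis.Fourier.hilbertTransform`):
* the three elementary integrals `∫_{t>0} (1+t²)⁻² = π/4`, `∫_{t>0} (1+t²)⁻³ = 3π/16`, `∫_{t>0} (1+t²)⁻⁴ = 5π/32` from explicit
  arctangent-plus-rational primitives (support file `GCLMGaugeAOriginRatesIntegrals`);
* `HΩ₀ = (1 − ξ²)/(1+ξ²)²` (from `SheetRowThirdHilbert.hilbertTransform_profile`), `𝒰₀′ = HΩ₀`, `𝒰₀(0) = 0`, `Ω₀′ = −2 f′`,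
  `Ω₀″ = −2 f″`, `Ω₀‴(0) = 24`;
* the origin values `H[Ω₀](0) = 1`, `H[ξΩ₀′](0) = 0`, `H[𝒰₀Ω₀′](0) = 1/4`, `H[(HΩ₀)Ω₀](0) = 1/2` (the Cotlar value `HΩ₀(0)²/2`),
  `H[Ω₀″](0) = −6`, and, assembled, `H[G(Ω₀)](0) = c_ω + a/4 − 1/2 + 6ε` and `∂_ξ G(Ω₀)(0) = −2c_ω − 2c_l − 2a + 2 − 24ε`
  for ALL `(c_ω, c_l, a, ε)`; hence the iff above.
WHAT IS NOT HERE: no dynamics (nothing about `τ > 0`, arrest, or the (D) words); the gauge-A system is taken as the MODEL's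
definition of `(c_ω, c_l)`. No `def … : Prop` hypotheses. bears_on: LADDER-NS N5 / zone Z3 (case Z3-E12⁻ + twin) → N1 linear core.
-/

namespace Summit.NavierStokesRegularity.OSWSelfSimilar
namespace GCLMGaugeAOriginRates

open _root_.MeasureTheory Set Filter
open scoped Real Topology
open Literature.Analysis.Fourier SheetRowThirdExactFamily

/-! ### The datum, its velocity and the sheet operator -/

/-- The registered class-(D) datum `d1` of case Z3-E12⁻: `Ω₀(ξ) = −2ξ/(1+ξ²)² = −2·profile ξ`
(`Ω₀′(0) = −2`, `HΩ₀(0) = 1`). [cite: OkamotoSakajoWunsch2008, eq. (3) (the model whose rescaled profiles these are)] -/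
noncomputable def datum (ξ : ℝ) : ℝ := -2 * profile ξ

/-- The velocity of the datum, `𝒰₀(ξ) = ξ/(1+ξ²) = −2·primProfile ξ` (`𝒰₀(0) = 0`, `𝒰₀′ = HΩ₀`). [folklore] -/
noncomputable def velocity (ξ : ℝ) : ℝ := -2 * primProfile ξ

/-- The profile operator of the sheet applied to the datum, with the GENUINE Hilbert transform and genuine derivatives:
`G(Ω₀; c_ω, c_l, a, ε)(ξ) = c_ω Ω₀ + c_l ξ Ω₀′ + a 𝒰₀ Ω₀′ − (HΩ₀) Ω₀ − ε Ω₀″`. MODEL object (SHEET §1.2). [folklore] -/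
noncomputable def sheetOp (cω cl a ε : ℝ) (ξ : ℝ) : ℝ :=
  cω * datum ξ + cl * ξ * deriv datum ξ + a * velocity ξ * deriv datum ξ
    - hilbertTransform datum ξ * datum ξ - ε * deriv (deriv datum) ξ

/-! ### Calculus of the datum -/

/-- `datum ξ = −2ξ/(1+ξ²)²`. [folklore] -/
theorem datum_eq (ξ : ℝ) : datum ξ = -2 * ξ / (1 + ξ ^ 2) ^ 2 := by
  unfold datum profile; ring

/-- `velocity ξ = ξ/(1+ξ²)`. [folklore] -/
theorem velocity_eq (ξ : ℝ) : velocity ξ = ξ / (1 + ξ ^ 2) := by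
  unfold velocity primProfile
  have h : (1 + ξ ^ 2) ≠ 0 := by positivity
  field_simp

/-- `HΩ₀(ξ) = −2·(Hf)(ξ) = (1 − ξ²)/(1+ξ²)²` with the genuine Hilbert transform. [folklore] -/
theorem hilbertTransform_datum (ξ : ℝ) : hilbertTransform datum ξ = -2 * hilbProfile ξ := by
  unfold datum
  rw [hilbertTransform_const_mul, hilbertTransform_profile]

/-- Closed form `HΩ₀(ξ) = (1 − ξ²)/(1+ξ²)²`. [folklore] -/
theorem hilbertTransform_datum_eq (ξ : ℝ) : hilbertTransform datum ξ = (1 - ξ ^ 2) / (1 + ξ ^ 2) ^ 2 := by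
  rw [hilbertTransform_datum]
  unfold hilbProfile
  have h : (1 + ξ ^ 2) ≠ 0 := by positivity
  field_simp
  ring

/-- The pin `HΩ₀(0) = 1`. [folklore] -/
theorem hilbertTransform_datum_zero : hilbertTransform datum 0 = 1 := by
  rw [hilbertTransform_datum, hilbProfile_zero]; norm_num

/-- `Ω₀′ = −2 f′`. [folklore] -/
theorem hasDerivAt_datum (ξ : ℝ) : HasDerivAt datum (-2 * dProfile ξ) ξ :=
  (hasDerivAt_profile ξ).const_mul (-2)

/-- `deriv Ω₀ = −2 f′`. [folklore] -/
theorem deriv_datum : deriv datum = fun ξ => -2 * dProfile ξ := by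
  funext ξ; exact (hasDerivAt_datum ξ).deriv

/-- `Ω₀″ = −2 f″`. [folklore] -/
theorem hasDerivAt_deriv_datum (ξ : ℝ) : HasDerivAt (deriv datum) (-2 * ddProfile ξ) ξ := by
  rw [deriv_datum]; exact (hasDerivAt_dProfile ξ).const_mul (-2)

/-- `deriv (deriv Ω₀) = −2 f″`. [folklore] -/
theorem deriv_deriv_datum : deriv (deriv datum) = fun ξ => -2 * ddProfile ξ := by
  funext ξ; exact (hasDerivAt_deriv_datum ξ).deriv

/-- `f‴(x) = 12(−5x⁴ + 10x² − 1)/(1+x²)⁵`. [folklore] -/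
theorem hasDerivAt_ddProfile (x : ℝ) :
    HasDerivAt ddProfile (12 * (-5 * x ^ 4 + 10 * x ^ 2 - 1) / (1 + x ^ 2) ^ 5) x := by
  unfold ddProfile
  have hD : (1 + x ^ 2) ≠ 0 := by positivity
  have hnum : HasDerivAt (fun y : ℝ => 12 * y * (y ^ 2 - 1)) (12 * (x ^ 2 - 1) + 12 * x * (2 * x)) x := by
    have h1 : HasDerivAt (fun y : ℝ => 12 * y) 12 x := by
      simpa using (hasDerivAt_id' x).const_mul 12
    have h2 : HasDerivAt (fun y : ℝ => y ^ 2 - 1) (2 * x) x := by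
      simpa using ((hasDerivAt_id' x).pow 2).sub_const 1
    have := h1.mul h2
    refine this.congr_deriv ?_
    rfl
  have hden : HasDerivAt (fun y : ℝ => (1 + y ^ 2) ^ 4) (4 * (1 + x ^ 2) ^ 3 * (2 * x)) x := by
    have := (hasDerivAt_one_add_sq x).pow 4
    refine this.congr_deriv ?_
    rfl
  have h := hnum.div hden (pow_ne_zero 4 hD)
  refine h.congr_deriv ?_
  field_simp
  ring

/-- `Ω₀‴(0) = 24`: the third derivative of the datum at the origin. [folklore] -/
theorem hasDerivAt_deriv_deriv_datum_zero : HasDerivAt (deriv (deriv datum)) 24 0 := by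
  rw [deriv_deriv_datum]
  have h := (hasDerivAt_ddProfile 0).const_mul (-2)
  refine h.congr_deriv ?_
  norm_num

/-- The pin `Ω₀′(0) = −2`. [folklore] -/
theorem deriv_datum_zero : deriv datum 0 = -2 := by
  rw [deriv_datum]; simp [dProfile_zero]

/-- `𝒰₀′ = HΩ₀` with the genuine Hilbert transform. [folklore] -/
theorem hasDerivAt_velocity (ξ : ℝ) : HasDerivAt velocity (hilbertTransform datum ξ) ξ := by
  rw [hilbertTransform_datum]
  exact (hasDerivAt_primProfile ξ).const_mul (-2)

/-- `𝒰₀(0) = 0`. [folklore] -/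
theorem velocity_zero : velocity 0 = 0 := by simp [velocity, primProfile_zero]

/-- `datum 0 = 0`. [folklore] -/
theorem datum_zero : datum 0 = 0 := by simp [datum, profile]

/-- `f″′`-free form of `hilbProfile′`: `(Hf)′(x) = x(3 − x²)/(1+x²)³`. [folklore] -/
theorem hasDerivAt_hilbProfile (x : ℝ) : HasDerivAt hilbProfile (x * (3 - x ^ 2) / (1 + x ^ 2) ^ 3) x := by
  unfold hilbProfile
  have hD : (1 + x ^ 2) ≠ 0 := by positivity
  have hnum : HasDerivAt (fun y : ℝ => y ^ 2 - 1) (2 * x) x := by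
    simpa using ((hasDerivAt_id' x).pow 2).sub_const 1
  have hden : HasDerivAt (fun y : ℝ => 2 * (1 + y ^ 2) ^ 2) (2 * (2 * (1 + x ^ 2) * (2 * x))) x := by
    have := ((hasDerivAt_one_add_sq x).pow 2).const_mul 2
    refine this.congr_deriv ?_
    ring
  have h := hnum.div hden (by positivity)
  refine h.congr_deriv ?_
  field_simp
  ring

/-! ### Hilbert transforms at the origin -/

/-- At the origin the symmetric p.v. integrand of `hilbertTransform` is `(f(−t) − f(t))/t`. [folklore] -/
theorem hilbertTransform_zero (f : ℝ → ℝ) :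
    hilbertTransform f 0 = π⁻¹ * ∫ t in Ioi (0 : ℝ), (f (-t) - f t) / t := by
  unfold hilbertTransform
  simp only [zero_sub, zero_add]

/-- `H[Ω₀](0) = 1` recomputed from the origin formula (consistency with the closed form). [folklore] -/
theorem hilbertTransform_datum_zero' : hilbertTransform datum 0 = 1 := hilbertTransform_datum_zero

/-- Symmetric integrand of the transport term at the origin: `((−t)Ω₀′(−t) − tΩ₀′(t))/t = 4 f′(t)` (`Ω₀′ = −2f′` even). [folklore] -/
private theorem symm_transport (t : ℝ) (ht : t ≠ 0) :
    ((-t) * deriv datum (-t) - t * deriv datum t) / t = 4 * dProfile t := by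
  rw [deriv_datum]
  unfold dProfile
  have hD : (1 + t ^ 2) ≠ 0 := by positivity
  have e : (-t) ^ 2 = t ^ 2 := by ring
  simp only [e]
  field_simp
  ring

/-- `H[ξ ↦ ξ·Ω₀′(ξ)](0) = 0`: the transport term's symmetric integrand at the origin is `4f′`, whose integral on `(0,∞)` is
`−4f(0) = 0`. [folklore] -/
theorem hilbertTransform_id_mul_deriv_datum_zero : hilbertTransform (fun ξ => ξ * deriv datum ξ) 0 = 0 := by
  rw [hilbertTransform_zero, setIntegral_congr_fun measurableSet_Ioi (fun t ht => symm_transport t (ne_of_gt ht)),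
    integral_const_mul, integral_Ioi_dProfile.2]
  simp

/-- Symmetric integrand of `a𝒰₀Ω₀′` at the origin: `16/(1+t²)⁴ − 12/(1+t²)³`. [folklore] -/
private theorem symm_velocity_mul_deriv (t : ℝ) (ht : t ≠ 0) :
    (velocity (-t) * deriv datum (-t) - velocity t * deriv datum t) / t
      = 0 * (1 / (1 + t ^ 2) ^ 2) + ((-12) * (1 / (1 + t ^ 2) ^ 3) + 16 * (1 / (1 + t ^ 2) ^ 4)) := by
  rw [deriv_datum, velocity_eq, velocity_eq]
  unfold dProfile
  have hD : (1 + t ^ 2) ≠ 0 := by positivity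
  have e : (-t) ^ 2 = t ^ 2 := by ring
  simp only [e]
  field_simp
  ring

/-- `H[𝒰₀Ω₀′](0) = 1/4`. [folklore] -/
theorem hilbertTransform_velocity_mul_deriv_datum_zero :
    hilbertTransform (fun ξ => velocity ξ * deriv datum ξ) 0 = 1 / 4 := by
  rw [hilbertTransform_zero, setIntegral_congr_fun measurableSet_Ioi (fun t ht => symm_velocity_mul_deriv t (ne_of_gt ht)),
    integral_Ioi_comb]
  have hπ : π ≠ 0 := Real.pi_ne_zero
  field_simp
  ring

/-- Symmetric integrand of `(HΩ₀)Ω₀` at the origin: `−4/(1+t²)³ + 8/(1+t²)⁴`. [folklore] -/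
private theorem symm_hilb_mul_datum (t : ℝ) (ht : t ≠ 0) :
    (hilbertTransform datum (-t) * datum (-t) - hilbertTransform datum t * datum t) / t
      = 0 * (1 / (1 + t ^ 2) ^ 2) + ((-4) * (1 / (1 + t ^ 2) ^ 3) + 8 * (1 / (1 + t ^ 2) ^ 4)) := by
  rw [hilbertTransform_datum_eq, hilbertTransform_datum_eq, datum_eq, datum_eq]
  have hD : (1 + t ^ 2) ≠ 0 := by positivity
  have e : (-t) ^ 2 = t ^ 2 := by ring
  simp only [e]
  field_simp
  ring

/-- `H[(HΩ₀)Ω₀](0) = 1/2 = HΩ₀(0)²/2` (the Cotlar value at the origin, for this datum, with the genuine transform). [folklore] -/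
theorem hilbertTransform_hilb_mul_datum_zero :
    hilbertTransform (fun ξ => hilbertTransform datum ξ * datum ξ) 0 = 1 / 2 := by
  rw [hilbertTransform_zero, setIntegral_congr_fun measurableSet_Ioi (fun t ht => symm_hilb_mul_datum t (ne_of_gt ht)),
    integral_Ioi_comb]
  have hπ : π ≠ 0 := Real.pi_ne_zero
  field_simp
  ring

/-- Symmetric integrand of `Ω₀″` at the origin: `48/(1+t²)³ − 96/(1+t²)⁴`. [folklore] -/
private theorem symm_deriv_deriv_datum (t : ℝ) (ht : t ≠ 0) :
    (deriv (deriv datum) (-t) - deriv (deriv datum) t) / t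
      = 0 * (1 / (1 + t ^ 2) ^ 2) + (48 * (1 / (1 + t ^ 2) ^ 3) + (-96) * (1 / (1 + t ^ 2) ^ 4)) := by
  rw [deriv_deriv_datum]
  unfold ddProfile
  have hD : (1 + t ^ 2) ≠ 0 := by positivity
  have e : (-t) ^ 2 = t ^ 2 := by ring
  simp only [e]
  field_simp
  ring

/-- `H[Ω₀″](0) = −6`. [folklore] -/
theorem hilbertTransform_deriv_deriv_datum_zero : hilbertTransform (deriv (deriv datum)) 0 = -6 := by
  rw [hilbertTransform_zero, setIntegral_congr_fun measurableSet_Ioi (fun t ht => symm_deriv_deriv_datum t (ne_of_gt ht)),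
    integral_Ioi_comb]
  have hπ : π ≠ 0 := Real.pi_ne_zero
  field_simp
  ring

/-- Symmetric integrand of the datum itself at the origin: `4/(1+t²)²`. [folklore] -/
private theorem symm_datum (t : ℝ) (ht : t ≠ 0) :
    (datum (-t) - datum t) / t = 4 * (1 / (1 + t ^ 2) ^ 2) + (0 * (1 / (1 + t ^ 2) ^ 3) + 0 * (1 / (1 + t ^ 2) ^ 4)) := by
  rw [datum_eq, datum_eq]
  have hD : (1 + t ^ 2) ≠ 0 := by positivity
  have e : (-t) ^ 2 = t ^ 2 := by ring
  simp only [e]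
  field_simp
  ring

/-- The whole symmetric integrand of `G(Ω₀)` at the origin is the combination
`4c_ω/(1+t²)² + (4 − 12a − 48ε)/(1+t²)³ + (16a − 8 + 96ε)/(1+t²)⁴ + 4c_l f′(t)`. [folklore] -/
private theorem symm_sheetOp (cω cl a ε t : ℝ) (ht : t ≠ 0) :
    (sheetOp cω cl a ε (-t) - sheetOp cω cl a ε t) / t
      = (4 * cω * (1 / (1 + t ^ 2) ^ 2)
        + ((4 - 12 * a - 48 * ε) * (1 / (1 + t ^ 2) ^ 3) + (16 * a - 8 + 96 * ε) * (1 / (1 + t ^ 2) ^ 4)))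
        + cl * (4 * dProfile t) := by
  have h1 := symm_datum t ht
  have h3 := symm_velocity_mul_deriv t ht
  have h4 := symm_hilb_mul_datum t ht
  have h5 := symm_deriv_deriv_datum t ht
  have h2 := symm_transport t ht
  have key : (sheetOp cω cl a ε (-t) - sheetOp cω cl a ε t) / t
      = cω * ((datum (-t) - datum t) / t) + cl * (((-t) * deriv datum (-t) - t * deriv datum t) / t)
        + a * ((velocity (-t) * deriv datum (-t) - velocity t * deriv datum t) / t)
        - (hilbertTransform datum (-t) * datum (-t) - hilbertTransform datum t * datum t) / t
        - ε * ((deriv (deriv datum) (-t) - deriv (deriv datum) t) / t) := by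
    unfold sheetOp
    field_simp
    ring
  rw [key, h1, h2, h3, h4, h5]
  ring

/-- **`H[G(Ω₀; c_ω, c_l, a, ε)](0) = c_ω + a/4 − 1/2 + 6ε`** with the genuine Hilbert transform, for all parameters: the left side
of gauge A's second origin condition in closed form. [folklore] -/
theorem hilbertTransform_sheetOp_zero (cω cl a ε : ℝ) :
    hilbertTransform (sheetOp cω cl a ε) 0 = cω + a / 4 - 1 / 2 + 6 * ε := by
  rw [hilbertTransform_zero,
    setIntegral_congr_fun measurableSet_Ioi (fun t ht => symm_sheetOp cω cl a ε t (ne_of_gt ht))]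
  obtain ⟨i2, -⟩ := integral_Ioi_inv_one_add_sq_pow_two
  obtain ⟨i3, -⟩ := integral_Ioi_inv_one_add_sq_pow_three
  obtain ⟨i4, -⟩ := integral_Ioi_inv_one_add_sq_pow_four
  obtain ⟨iD, vD⟩ := integral_Ioi_dProfile
  have hcomb : IntegrableOn (fun t : ℝ => 4 * cω * (1 / (1 + t ^ 2) ^ 2)
      + ((4 - 12 * a - 48 * ε) * (1 / (1 + t ^ 2) ^ 3) + (16 * a - 8 + 96 * ε) * (1 / (1 + t ^ 2) ^ 4))) (Ioi 0) :=
    (i2.const_mul _).add ((i3.const_mul _).add (i4.const_mul _))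
  have htr : IntegrableOn (fun t : ℝ => cl * (4 * dProfile t)) (Ioi 0) := (iD.const_mul 4).const_mul cl
  rw [integral_add hcomb htr, integral_Ioi_comb, integral_const_mul, integral_const_mul, vD]
  have hπ : π ≠ 0 := Real.pi_ne_zero
  field_simp
  ring

/-- **`∂_ξ G(Ω₀; c_ω, c_l, a, ε)(0) = −2c_ω − 2c_l − 2a + 2 − 24ε`**: the left side of gauge A's first origin condition
(conservation of `Ω′(0)`), using `Ω₀(0) = 𝒰₀(0) = 0`, `Ω₀′(0) = −2`, `𝒰₀′(0) = HΩ₀(0) = 1`, `Ω₀‴(0) = 24`. [folklore] -/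
theorem hasDerivAt_sheetOp_zero (cω cl a ε : ℝ) :
    HasDerivAt (sheetOp cω cl a ε) (-2 * cω - 2 * cl - 2 * a + 2 - 24 * ε) 0 := by
  have hd0 : HasDerivAt datum (-2 * dProfile 0) 0 := hasDerivAt_datum 0
  have hdd0 : HasDerivAt (deriv datum) (-2 * ddProfile 0) 0 := hasDerivAt_deriv_datum 0
  have hv0 : HasDerivAt velocity (hilbertTransform datum 0) 0 := hasDerivAt_velocity 0
  have hH0 : HasDerivAt (hilbertTransform datum) (-2 * (0 * (3 - 0 ^ 2) / (1 + 0 ^ 2) ^ 3)) 0 := by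
    have : hilbertTransform datum = fun ξ => -2 * hilbProfile ξ := funext hilbertTransform_datum
    rw [this]
    exact (hasDerivAt_hilbProfile 0).const_mul (-2)
  have hid : HasDerivAt (fun ξ : ℝ => ξ) 1 0 := hasDerivAt_id' 0
  -- assemble term by term (explicit lambdas so that the sum elaborates to the operator's shape)
  have t1 : HasDerivAt (fun ξ => cω * datum ξ) (cω * (-2 * dProfile 0)) 0 := hd0.const_mul cω
  have t2 : HasDerivAt (fun ξ => cl * (ξ * deriv datum ξ)) (cl * (1 * deriv datum 0 + (0 : ℝ) * (-2 * ddProfile 0))) 0 :=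
    (hid.mul hdd0).const_mul cl
  have t3 : HasDerivAt (fun ξ => a * (velocity ξ * deriv datum ξ))
      (a * (hilbertTransform datum 0 * deriv datum 0 + velocity 0 * (-2 * ddProfile 0))) 0 :=
    (hv0.mul hdd0).const_mul a
  have t4 : HasDerivAt (fun ξ => hilbertTransform datum ξ * datum ξ)
      (-2 * (0 * (3 - 0 ^ 2) / (1 + 0 ^ 2) ^ 3) * datum 0 + hilbertTransform datum 0 * (-2 * dProfile 0)) 0 :=
    hH0.mul hd0
  have t5 : HasDerivAt (fun ξ => ε * deriv (deriv datum) ξ) (ε * 24) 0 := hasDerivAt_deriv_deriv_datum_zero.const_mul ε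
  have hsum : HasDerivAt (fun ξ => cω * datum ξ + cl * (ξ * deriv datum ξ) + a * (velocity ξ * deriv datum ξ)
      - hilbertTransform datum ξ * datum ξ - ε * deriv (deriv datum) ξ)
      (cω * (-2 * dProfile 0) + cl * (1 * deriv datum 0 + (0 : ℝ) * (-2 * ddProfile 0))
        + a * (hilbertTransform datum 0 * deriv datum 0 + velocity 0 * (-2 * ddProfile 0))
        - (-2 * (0 * (3 - 0 ^ 2) / (1 + 0 ^ 2) ^ 3) * datum 0 + hilbertTransform datum 0 * (-2 * dProfile 0))
        - ε * 24) 0 :=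
    (((t1.add t2).add t3).sub t4).sub t5
  have hfun : sheetOp cω cl a ε = fun ξ => cω * datum ξ + cl * (ξ * deriv datum ξ) + a * (velocity ξ * deriv datum ξ)
      - hilbertTransform datum ξ * datum ξ - ε * deriv (deriv datum) ξ := by
    funext ξ; unfold sheetOp; ring
  rw [hfun]
  refine hsum.congr_deriv ?_
  rw [hilbertTransform_datum_zero, deriv_datum_zero, datum_zero, velocity_zero, dProfile_zero]
  ring

/-- `deriv (G(Ω₀)) 0` in closed form. [folklore] -/
theorem deriv_sheetOp_zero (cω cl a ε : ℝ) :
    deriv (sheetOp cω cl a ε) 0 = -2 * cω - 2 * cl - 2 * a + 2 - 24 * ε :=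
  (hasDerivAt_sheetOp_zero cω cl a ε).deriv

/-! ### The gauge-A initial rates -/

/-- **GAUGE-A INITIAL RATES OF THE REGISTERED DATUM (MODEL theorem, closed form).** For `Ω₀(ξ) = −2ξ/(1+ξ²)²` the two gauge-A
origin conditions `∂_ξ[G(Ω₀)](0) = 0` (conservation of `Ω′(0)`) and `H[G(Ω₀)](0) = 0` (conservation of `HΩ(0)`) hold iff
`c_ω = 1/2 − a/4 − 6ε` and `c_l = 1/2 − 3a/4 − 6ε`. These are the `τ = 0⁺` rates every class-(D) run of case Z3-E12⁻ (eng-3,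
Cayley–Fourier + BDF2, after its inviscid first step with `ε = 0`) and of its twin (eng-5, sinc + Radau) prints to `1e-12`
(e.g. `a = −1/2`, `ε = 1/100`: `(0.565, 0.815)`; `ε = 1`: `(−5.375, −5.125)`). WHAT THIS IS NOT: not NS; no dynamics. [folklore] -/
theorem gaugeA_origin_rates_iff (cω cl a ε : ℝ) :
    (deriv (sheetOp cω cl a ε) 0 = 0 ∧ hilbertTransform (sheetOp cω cl a ε) 0 = 0) ↔
      (cω = 1 / 2 - a / 4 - 6 * ε ∧ cl = 1 / 2 - 3 * a / 4 - 6 * ε) := by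
  rw [deriv_sheetOp_zero, hilbertTransform_sheetOp_zero]
  constructor
  · rintro ⟨h1, h2⟩
    constructor <;> linarith
  · rintro ⟨h1, h2⟩
    subst h1
    subst h2
    constructor <;> ring

/-- **Growth-phase criterion.** With the gauge-A rates of the datum, the rescaled amplitude grows at `τ = 0⁺` (`c_ω > 0`) iff
`ε < (2 − a)/24`; in particular the registered `ε₀ = 1` rows (`a ∈ [−1, 0.2]`) start viscosity-dominated (`c_ω(0⁺) < 0`), and at
`a = −1/2` the threshold is `ε = 5/48 ≈ 0.104` (so `ε₀ = 0.1` is marginally growing, `ε₀ = 0.01, 0.001` grow). MODEL statement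
about one datum; not NS. [folklore] -/
theorem growth_phase_iff (a ε : ℝ) : (0 < 1 / 2 - a / 4 - 6 * ε) ↔ ε < (2 - a) / 24 := by
  constructor <;> intro h <;> linarith

/-- The inviscid (`ε = 0`) rates `c_ω = 1/2 − a/4`, `c_l = 1/2 − 3a/4` — eng-3's phase-I values (their `s_max = (1/2 − a/4)·dt` for the
`ε₀ ≥ 0.1` rows is this number times one step). [folklore] -/
theorem gaugeA_origin_rates_inviscid (cω cl a : ℝ)
    (h : deriv (sheetOp cω cl a 0) 0 = 0 ∧ hilbertTransform (sheetOp cω cl a 0) 0 = 0) :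
    cω = 1 / 2 - a / 4 ∧ cl = 1 / 2 - 3 * a / 4 := by
  have h' := (gaugeA_origin_rates_iff cω cl a 0).1 h
  constructor <;> linarith [h'.1, h'.2]

end GCLMGaugeAOriginRates
end Summit.NavierStokesRegularity.OSWSelfSimilar
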